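import Summits.Ventures.PercRepro.RankLevelSetTriangleMatching

/-!
# PercRepro — THE SPANNING TAIL WITH MANY DISJOINT TRIANGLES (p8 g14, S3): the matching lever, part 2

A family of pairwise disjoint circuits inside `X ⊆ E` is removable one point each (`eRk_add_card_le_encard_of_disjoint_circuits`),
so the complement of a spanning set of nullity `d − j` meets at least `j − (d − k)` of `k` pairwise disjoint triangles, and the
`j`-sets meeting `i` given disjoint triangles number at most `3^i·C(n, j − i)` (`card_filter_meets_all_le`, part 1):
**`ncard_spanning_le_of_disjoint_triangles`** —
`#spanning ≤ Σ_{j ≤ j₀} C(n, j) + Σ_{j₀ < j ≤ d} C(k, j − (d − k))·3^{j − (d − k)}·C(n, d − k)` (`d − k ≤ j₀`).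
At `(22, 12)` with `k = 10`, `j₀ = 9`: `386 843 756 = 2.25 %` of `2^34` against the crude `6.07 %`. Axioms: standard.
-/

namespace PercRepro

open Finset Set

variable {α : Type*}

namespace Matroid

variable {M : _root_.Matroid α} [M.Finite]

omit [M.Finite] in
/-- **Disjoint circuits inside `X ⊆ E` are removable one point each**: `r(X) + |I| ≤ |X|` for a family `I` of pairwise
disjoint circuits contained in `X`. -/
theorem eRk_add_card_le_encard_of_disjoint_circuits {X : Set α} (hXE : X ⊆ M.E) (I : Finset (Set α))
    (hI : ∀ C ∈ I, M.IsCircuit C) (hdisj : ∀ C ∈ I, ∀ C' ∈ I, C ≠ C' → Disjoint C C')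
    (hX : ∀ C ∈ I, C ⊆ X) : M.eRk X + (I.card : ℕ∞) ≤ X.encard := by
  classical
  rcases isEmpty_or_nonempty α with hα | hα
  · have hI0 : I = ∅ := by
      rw [Finset.eq_empty_iff_forall_notMem]
      intro C hC
      exact (hI C hC).nonempty.elim (fun x _ => hα.elim x)
    simp only [hI0, Finset.card_empty, Nat.cast_zero, add_zero]
    exact M.eRk_le_encard X
  have hpick : ∀ C, ∃ x : α, C ∈ I → x ∈ C := by
    intro C
    by_cases hC : C ∈ I
    · exact ⟨(hI C hC).nonempty.choose, fun _ => (hI C hC).nonempty.choose_spec⟩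
    · exact ⟨Classical.arbitrary α, fun h => absurd h hC⟩
  choose p hp using hpick
  set P : Set α := p '' (I : Set (Set α)) with hP
  have hPinj : Set.InjOn p (I : Set (Set α)) := by
    intro C hC C₁ hC₁ heq
    by_contra hne
    have hdisj' := hdisj C (Finset.mem_coe.1 hC) C₁ (Finset.mem_coe.1 hC₁) hne
    have h1 := hp C (Finset.mem_coe.1 hC)
    have h2 := hp C₁ (Finset.mem_coe.1 hC₁)
    rw [← heq] at h2
    exact Set.disjoint_left.1 hdisj' h1 h2
  have hPcard : P.ncard = I.card := by rw [hP, hPinj.ncard_image, Set.ncard_coe_finset]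
  have hPfin : P.Finite := I.finite_toSet.image p
  have hPX : P ⊆ X := by
    rintro x ⟨C, hC, rfl⟩
    exact hX C (Finset.mem_coe.1 hC) (hp C (Finset.mem_coe.1 hC))
  have hcl : X ⊆ M.closure (X \ P) := by
    intro x hx
    by_cases hxP : x ∈ P
    · obtain ⟨C, hC, rfl⟩ := hxP
      have hC2 := Finset.mem_coe.1 hC
      refine mem_closure_sdiff_of_isCircuit (hI C hC2) (hp C hC2) (hX C hC2) ?_
      intro y hy hyx hyP
      obtain ⟨C₁, hC₁, rfl⟩ := hyP
      have hC₁2 := Finset.mem_coe.1 hC₁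
      by_cases hCC : C₁ = C
      · subst hCC; exact hyx rfl
      · exact Set.disjoint_left.1 (hdisj C hC2 C₁ hC₁2 (Ne.symm hCC)) hy (hp C₁ hC₁2)
    · exact M.subset_closure (X \ P) (Set.sdiff_subset.trans hXE) ⟨hx, hxP⟩
  have := eRk_add_encard_le_of_subset_closure hPX hcl
  rwa [← hPfin.cast_ncard_eq, hPcard] at this

/-- **THE SPANNING TAIL WITH `k` DISJOINT TRIANGLES.** `|E| = r(E) + d`, `n = |E|`, a family `𝒟` of `k ≤ d` pairwise disjoint
triangles, `d − k ≤ j₀ ≤ d`: the complement of a spanning set of nullity `d − j` (a `j`-set) meets at least `j − (d − k)`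
of the triangles, so
`#spanning ≤ Σ_{j ≤ j₀} C(n, j) + Σ_{j₀ < j ≤ d} C(k, j − (d − k))·3^{j − (d − k)}·C(n, d − k)`. -/
theorem ncard_spanning_le_of_disjoint_triangles {d k : ℕ} (hd : M.E.encard = M.eRank + d) (hkd : k ≤ d)
    (𝒟 : Finset (Set α)) (h𝒟 : ∀ C ∈ 𝒟, M.IsCircuit C ∧ C.ncard = 3)
    (hdisj : ∀ C ∈ 𝒟, ∀ C' ∈ 𝒟, C ≠ C' → Disjoint C C') (hk : 𝒟.card = k) (j₀ : ℕ) (hj₀ : d - k ≤ j₀) :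
    {X : Set α | X ⊆ M.E ∧ M.eRk X = M.eRank}.ncard ≤
      (∑ j ∈ Finset.range (j₀ + 1), M.ground_finite.toFinset.card.choose j) +
        ∑ j ∈ Finset.Ico (j₀ + 1) (d + 1),
          k.choose (j - (d - k)) * 3 ^ (j - (d - k)) * M.ground_finite.toFinset.card.choose (d - k) := by
  classical
  set E' := M.ground_finite.toFinset with hE'
  have hE : (E' : Set α) = M.E := Set.Finite.coe_toFinset _
  set n := E'.card with hn
  have h𝒟E : ∀ C ∈ 𝒟, C ⊆ (E' : Set α) := fun C hC => by rw [hE]; exact (h𝒟 C hC).1.subset_ground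
  -- the target families
  set Y₀ := {Y : Set α | Y ⊆ (E' : Set α) ∧ Y.ncard ≤ j₀} with hY₀
  let Yj : ℕ → Set (Set α) := fun j => ⋃ I ∈ 𝒟.powersetCard (j - (d - k)),
    {Y : Set α | Y ⊆ (E' : Set α) ∧ Y.ncard = j ∧ ∀ C ∈ I, (Y ∩ C).Nonempty}
  set 𝒴 := Y₀ ∪ ⋃ j ∈ Finset.Ico (j₀ + 1) (d + 1), Yj j with h𝒴
  have hfinYj : ∀ j, (Yj j).Finite := fun j =>
    (𝒟.powersetCard (j - (d - k))).finite_toSet.biUnion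
      (fun I _ => (E'.finite_toSet.finite_subsets).subset (fun Y hY => hY.1))
  have hfin𝒴 : 𝒴.Finite :=
    ((E'.finite_toSet.finite_subsets).subset (fun Y hY => hY.1)).union
      ((Finset.Ico (j₀ + 1) (d + 1)).finite_toSet.biUnion (fun j _ => hfinYj j))
  -- the complement map
  have hinj : Set.InjOn (fun X : Set α => M.E \ X) {X : Set α | X ⊆ M.E ∧ M.eRk X = M.eRank} := by
    intro X hX Y hY hXY
    simp only at hXY
    rw [← Set.sdiff_sdiff_cancel_left hX.1, hXY, Set.sdiff_sdiff_cancel_left hY.1]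
  have hR' : M.eRank ≠ ⊤ := (M.eRank_ne_top_iff).2 inferInstance
  have hmaps : ∀ X ∈ {X : Set α | X ⊆ M.E ∧ M.eRk X = M.eRank}, (fun X : Set α => M.E \ X) X ∈ 𝒴 := by
    intro X hX
    show M.E \ X ∈ 𝒴
    obtain ⟨hle, hsum⟩ := diff_ncard_le_of_spanning hd hX.1 hX.2
    have hYE : M.E \ X ⊆ (E' : Set α) := by rw [hE]; exact Set.sdiff_subset
    have hfinY : (M.E \ X).Finite := M.ground_finite.subset Set.sdiff_subset
    set j := (M.E \ X).ncard with hj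
    rcases Nat.lt_or_ge j (j₀ + 1) with hlt | hge
    · exact Or.inl ⟨hYE, by omega⟩
    · -- `X` has nullity `d − j`: it contains at most `d − j` of the triangles, so `E ∖ X` meets `≥ j − (d − k)`
      have hXcard : X.encard = M.eRank + ((d - j : ℕ) : ℕ∞) := by
        rw [hfinY.cast_ncard_eq.symm, ← hj] at hsum
        have hsum' : X.encard + (j : ℕ∞) = (M.eRank + ((d - j : ℕ) : ℕ∞)) + (j : ℕ∞) := by
          rw [hsum, add_assoc, ← Nat.cast_add, Nat.sub_add_cancel hle]
        exact (ENat.add_le_add_iff_right (by simp)).1 hsum'.le |>.antisymm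
          ((ENat.add_le_add_iff_right (by simp)).1 hsum'.ge)
      set Iin := 𝒟.filter (fun C => C ⊆ X) with hIin
      have hIin_le : Iin.card ≤ d - j := by
        have h1 := eRk_add_card_le_encard_of_disjoint_circuits hX.1 Iin
          (fun C hC => (h𝒟 C (Finset.mem_filter.1 hC).1).1)
          (fun C hC C' hC' hne => hdisj C (Finset.mem_filter.1 hC).1 C' (Finset.mem_filter.1 hC').1 hne)
          (fun C hC => (Finset.mem_filter.1 hC).2)
        rw [hX.2, hXcard] at h1
        have h2 : ((Iin.card : ℕ) : ℕ∞) ≤ ((d - j : ℕ) : ℕ∞) := (ENat.add_le_add_iff_left hR').1 h1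
        exact_mod_cast h2
      set Imet := 𝒟.filter (fun C => ((M.E \ X) ∩ C).Nonempty) with hImet
      have hmet_card : j - (d - k) ≤ Imet.card := by
        have hsplit : 𝒟.card = Imet.card + Iin.card := by
          rw [hImet, hIin]
          have := Finset.card_filter_add_card_filter_not (s := 𝒟) (fun C => ((M.E \ X) ∩ C).Nonempty)
          rw [← this]
          congr 1
          apply Finset.card_bij (fun C _ => C)
          · intro C hC
            rw [Finset.mem_filter] at hC ⊢
            refine ⟨hC.1, ?_⟩
            intro x hx
            by_contra hxX
            have hne : ((M.E \ X) ∩ C).Nonempty := ⟨x, ⟨(h𝒟 C hC.1).1.subset_ground hx, hxX⟩, hx⟩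
            exact hC.2 hne
          · intro C _ C' _ h; exact h
          · intro C hC
            refine ⟨C, ?_, rfl⟩
            rw [Finset.mem_filter] at hC ⊢
            refine ⟨hC.1, ?_⟩
            rw [Set.not_nonempty_iff_eq_empty]
            apply Set.eq_empty_of_forall_notMem
            intro x hx
            exact hx.1.2 (hC.2 hx.2)
        omega
      obtain ⟨I, hIsub, hIcard⟩ := Finset.exists_subset_card_eq hmet_card
      refine Or.inr ?_
      rw [Set.mem_iUnion₂]
      refine ⟨j, Finset.mem_Ico.2 ⟨hge, by omega⟩, ?_⟩
      rw [Set.mem_iUnion₂]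
      refine ⟨I, Finset.mem_powersetCard.2 ⟨hIsub.trans (Finset.filter_subset _ _), hIcard⟩, hYE, rfl, ?_⟩
      intro C hC
      exact (Finset.mem_filter.1 (hIsub hC)).2
  have hmain : {X : Set α | X ⊆ M.E ∧ M.eRk X = M.eRank}.ncard ≤ 𝒴.ncard :=
    Set.ncard_le_ncard_of_injOn _ hmaps hinj hfin𝒴
  -- the counts
  have h₀ : Y₀.ncard ≤ ∑ j ∈ Finset.range (j₀ + 1), n.choose j := ncard_subsets_ncard_le E' j₀
  have hj : ∀ j, d - k ≤ j → (Yj j).ncard ≤ k.choose (j - (d - k)) * 3 ^ (j - (d - k)) * n.choose (d - k) := by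
    intro j hjdk
    have h1 := ncard_biUnion_le_sum (𝒟.powersetCard (j - (d - k)))
      (fun I => {Y : Set α | Y ⊆ (E' : Set α) ∧ Y.ncard = j ∧ ∀ C ∈ I, (Y ∩ C).Nonempty})
      (fun I _ => (E'.finite_toSet.finite_subsets).subset (fun Y hY => hY.1))
    have h2 : ∀ I ∈ 𝒟.powersetCard (j - (d - k)),
        {Y : Set α | Y ⊆ (E' : Set α) ∧ Y.ncard = j ∧ ∀ C ∈ I, (Y ∩ C).Nonempty}.ncard ≤
          3 ^ (j - (d - k)) * n.choose (d - k) := by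
      intro I hI
      rw [Finset.mem_powersetCard] at hI
      rw [ncard_subsets_ncard_eq_filter E' j (fun Y : Set α => ∀ C ∈ I, (Y ∩ C).Nonempty)]
      have h3 := card_filter_meets_all_le E' I (fun C hC => (h𝒟 C (hI.1 hC)).2) (fun C hC => h𝒟E C (hI.1 hC))
        (fun C hC C' hC' hne => hdisj C (hI.1 hC) C' (hI.1 hC') hne) j
      rw [hI.2] at h3
      have hjj : j - (j - (d - k)) = d - k := by omega
      rw [hjj] at h3
      convert h3 using 2
    calc (Yj j).ncard ≤ ∑ I ∈ 𝒟.powersetCard (j - (d - k)),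
          {Y : Set α | Y ⊆ (E' : Set α) ∧ Y.ncard = j ∧ ∀ C ∈ I, (Y ∩ C).Nonempty}.ncard := h1
      _ ≤ ∑ _I ∈ 𝒟.powersetCard (j - (d - k)), 3 ^ (j - (d - k)) * n.choose (d - k) := Finset.sum_le_sum h2
      _ = k.choose (j - (d - k)) * 3 ^ (j - (d - k)) * n.choose (d - k) := by
          rw [Finset.sum_const, Finset.card_powersetCard, hk, smul_eq_mul, mul_assoc]
  have hU : (⋃ j ∈ Finset.Ico (j₀ + 1) (d + 1), Yj j).ncard ≤
      ∑ j ∈ Finset.Ico (j₀ + 1) (d + 1), k.choose (j - (d - k)) * 3 ^ (j - (d - k)) * n.choose (d - k) :=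
    (ncard_biUnion_le_sum _ Yj (fun j _ => hfinYj j)).trans
      (Finset.sum_le_sum (fun j hjm => hj j (by have := (Finset.mem_Ico.1 hjm).1; omega)))
  calc {X : Set α | X ⊆ M.E ∧ M.eRk X = M.eRank}.ncard ≤ 𝒴.ncard := hmain
    _ ≤ Y₀.ncard + (⋃ j ∈ Finset.Ico (j₀ + 1) (d + 1), Yj j).ncard := Set.ncard_union_le _ _
    _ ≤ _ := add_le_add h₀ hU

end Matroid

end PercRepro
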